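import Literature.Computability.QuantumComplexity.QuantumTuringADHAngle
import Literature.Computability.QuantumComplexity.QuantumTuringADHProofs
import Literature.Computability.QuantumComplexity.QuantumTuringCircuitDirection
import Literature.Computability.QuantumComplexity.EffectiveCompilation
import Literature.Computability.QuantumComplexity.HTCnotUniversalityDensityProofs
import Literature.Computability.QuantumComplexity.BarencoUniversalityProofs
import HarnessLib

/-!
# The Adleman–DeMarrais–Huang gate set `{R_θ, R_θ⁻¹, P_θ, P_θ⁻¹, CNOT}` is universal, and S05 reduces to a circuit executor

Proof infrastructure for **quantum-advantage.S05**
(`Literature.Computability.QuantumComplexity.BQPQTMWith_adhAmplitudes`: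
`BQPQTMWith adhAmplitudes = BQPQTM`, Adleman–DeMarrais–Huang, *Quantum computability*, SIAM J.
Comput. 26 (1997), Thm. 3.1 / Cor. 3.2 via Thm. 3.3(e): the angle `θ` with `cos θ = 3/5`,
`sin θ = 4/5` is a universal primitive rotation, so amplitudes in `{0, ±3/5, ±4/5, ±1}` suffice for
`BQP`). This file takes the CIRCUIT route to the missing inclusion `BQPQTM ⊆ BQPQTMWith adhAmplitudes`
(seat 1, "library-first"), which the tree now supports almost to the end:

* `BQPQTM ⊆ BQP` is a theorem of the tree: the head-centred simulation of an arbitrary well-formed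
  machine in the tree's translation-quotient semantics (`Cryptography/QuantumTuringMachineHeadCentred*.lean`,
  Nishimura–Ozawa 2002, Thm. 4.3 with Bernstein–Vazirani 1997, Lemma 5.5) and gate-set independence
  `BQPOver_eq_BQP_holds` (the effective Solovay–Kitaev theorem, `EffectiveCompilation.lean`) give
  `BQPQTM_subset_BQP_of_gateSetIndependence BQPOver_eq_BQP_holds` (`QuantumTuringCircuitDirection.lean`);
  it is recorded here as `BQPQTM_subset_BQP`.
* **This file**: the finite gate set `adhGateSet = {R_θ, R_θ⁻¹, P_θ, P_θ⁻¹, CNOT}` — the 3-4-5 rotation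
  `R_θ = [[3/5, -4/5], [4/5, 3/5]]`, the phase gate `P_θ = diag(1, e^{iθ}) = diag(1, (3+4i)/5)`, their
  inverses, and `CNOT` — whose entries `0, 1, 3/5, ±4/5, (3 ± 4i)/5` have real and imaginary parts in
  `adhAmplitudes` (`adhGateSet_re_mem_adhAmplitudes`, `adhGateSet_im_mem_adhAmplitudes`), satisfies the
  four hypotheses of `BQPOver_eq_BQP`: it is unitary, inverse-closed, has polynomial-time computable
  (indeed rational complex) entries, and is **universal at the placement level**
  (`adhGateSet_isUniversal`): `⟨R_θ, P_θ, phases⟩` is dense in `U(2)` because the closed subgroup it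
  generates contains the diagonal torus (`e^{iθ} = (3+4i)/5` is not a root of unity, i.e. `θ/2π ∉ ℚ`,
  `irrational_adhAngle_div_two_pi` — Adleman–DeMarrais–Huang's reduction (e) ⇒ (d) ⇒ (c), p. 1530 —
  and Kronecker's theorem) and the real rotation `R_θ` with `cos θ sin θ ≠ 0`, which does not normalise
  the torus (`unitaryGroup_fin_two_eq_top_of_diagU_mem`); with `CNOT`, Barenco et al. 1995
  (`barenco1995_exactUniversality_holds`) lifts this to `U(2^n)` for every `n ≥ 1`, exactly as in the
  tree's proof for Clifford+`T` (`hTCnot_generatesDenselyModPhase_of`). Hence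
  **`BQPOver adhGateSet = BQP`** (`BQPOver_adhGateSet_eq_BQP`) and `BQPQTM ⊆ BQPOver adhGateSet`.
* **The reduction** (`BQPQTM_subset_BQPQTMWith_adhAmplitudes_of_exec`): the missing inclusion of S05 follows
  from ONE machine-level statement,
  `BQPOver adhGateSet ⊆ BQPQTMWith adhAmplitudes` — a well-formed quantum Turing machine with (real)
  amplitudes in `{0, ±3/5, ±4/5, ±1}` executing a polynomial-time uniform family of `adhGateSet`-circuits
  (Nishimura–Ozawa 2002, Lemma 4.4 / Thm. 5.2 and Yao 1993 for the executor; the complex entries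
  `(3 ± 4i)/5` are carried by one extra tape bit holding "real/imaginary part", the standard
  realification `a + ib ↦ [[a, -b], [b, a]]` of Bernstein–Vazirani 1997, whose
  transition amplitudes are again `3/5, ±4/5`). This is the `adhAmplitudes` twin of the one remaining
  hypothesis `BQP ⊆ BQPQTM` of S04 (`BQPQTM_eq_BQP_of_gateSetIndependence`); neither executor exists in
  the tree yet. Conversely, given that executor for Clifford+`T` (i.e. S04), S05 is EQUIVALENT to the
  displayed inclusion (`exec_of_BQPQTMWith_adhAmplitudes`).

Relation to the printed proof. Adleman–DeMarrais–Huang replace each `R`-rotation of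
Bernstein–Vazirani's universal machine by `a < f(1/δ)` rotations by `θ` (Lemma 3.5), which needs
`θ/2π` non-Liouville (Lemma 3.6 / Thm. 3.7, Feldman's bound for linear forms in two logarithms). The
circuit route replaces this Diophantine input by the Solovay–Kitaev theorem for the NON-COMMUTING pair
`R_θ` (a `Y`-rotation by `2θ`) and `P_θ` (a `Z`-rotation by `θ`), for which plain irrationality of
`θ/2π` suffices; the price is the complex gate `P_θ` and its realification in the executor.

Everything below is proved; no named fact is introduced.

## References

* L. M. Adleman, J. DeMarrais, M.-D. A. Huang, *Quantum computability*, SIAM J. Comput. 26 (1997)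
  1524–1540 [AdlemanDeMarraisHuangSICOMP1997]: §2 (`QTM_θ`, p. 1526), Thm. 3.1, Cor. 3.2,
  Thm. 3.3 (a)–(e) and its proof, pp. 1527–1530.
* E. Bernstein, U. Vazirani, *Quantum complexity theory*, SIAM J. Comput. 26 (1997) 1411–1473
  [BernsteinVazirani1997], §8 (`BQP`), Lemma 5.5.
* H. Nishimura, M. Ozawa, Theoret. Comput. Sci. 276 (2002) 147–181 [NishimuraOzawa2002], Thm. 4.3,
  Lemma 4.4, Thm. 5.2.
* A. Barenco et al., Phys. Rev. A 52 (1995) 3457–3467 [BarencoEtAl1995], abstract and §8.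
* P. O. Boykin, T. Mor, M. Pulver, V. Roychowdhury, F. Vatan, FOCS 1999 [Boykin1999FOCS], §3.
* C. M. Dawson, M. A. Nielsen, Quantum Inf. Comput. 6 (2006) 81–95 [DawsonNielsen2006], Thm. 1.
-/

noncomputable section

namespace Literature.Computability.QuantumComplexity

open Matrix Complex Cryptography

/-! ### The gates -/

/-- The gate symbols of the Adleman–DeMarrais–Huang gate set: the 3-4-5 rotation and its inverse, the
3-4-5 phase gate and its inverse, and `CNOT`. [cite: AdlemanDeMarraisHuangSICOMP1997, §2 (QTM_θ) and Thm. 3.3(e)] -/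
inductive ADHOp
  | R
  | Rinv
  | P
  | Pinv
  | CNOT
  deriving DecidableEq, Fintype, Inhabited

/-- `ADHOp` is encodable, via `Fin 5`. [folklore] -/
instance : Encodable ADHOp := Encodable.ofEquiv (Fin 5)
  { toFun := fun g => match g with | .R => 0 | .Rinv => 1 | .P => 2 | .Pinv => 3 | .CNOT => 4
    invFun := fun i => match i with | 0 => .R | 1 => .Rinv | 2 => .P | 3 => .Pinv | 4 => .CNOT
    left_inv := fun g => by cases g <;> rfl
    right_inv := fun i => by fin_cases i <;> rfl }

/-- The unimodular Gaussian rational `e^{iθ} = (3 + 4i)/5` of the Adleman–DeMarrais–Huang angle.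
[cite: AdlemanDeMarraisHuangSICOMP1997, Thm. 3.3(e)] -/
def adhUnit : ℂ := (3 + 4 * I) / 5

/-- Its conjugate `e^{-iθ} = (3 - 4i)/5`. [cite: AdlemanDeMarraisHuangSICOMP1997, Thm. 3.3(e)] -/
def adhUnitInv : ℂ := (3 - 4 * I) / 5

/-- **The 3-4-5 rotation** `R_θ = [[cos θ, -sin θ], [sin θ, cos θ]] = [[3/5, -4/5], [4/5, 3/5]]` on one
qubit (`R_θ |0⟩ = 3/5 |0⟩ + 4/5 |1⟩`): the `2 × 2` block of the local matrices of ADH's class `QTM_θ`.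
[cite: AdlemanDeMarraisHuangSICOMP1997, §2 (QTM_θ, p. 1526)] -/
def adhRotGate : Matrix (QReg 1) (QReg 1) ℂ :=
  Matrix.of fun x y => if x 0 = y 0 then (3 / 5 : ℂ) else if x 0 = true then (4 / 5 : ℂ) else -(4 / 5 : ℂ)

/-- The inverse rotation `R_θ⁻¹ = R_{-θ} = [[3/5, 4/5], [-4/5, 3/5]]`. [cite: AdlemanDeMarraisHuangSICOMP1997, §2 (QTM_θ, p. 1526)] -/
def adhRotInvGate : Matrix (QReg 1) (QReg 1) ℂ :=
  Matrix.of fun x y => if x 0 = y 0 then (3 / 5 : ℂ) else if x 0 = true then -(4 / 5 : ℂ) else (4 / 5 : ℂ)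

/-- **The 3-4-5 phase gate** `P_θ = diag(1, e^{iθ}) = diag(1, (3+4i)/5)`. [folklore] -/
def adhPhaseGate : Matrix (QReg 1) (QReg 1) ℂ :=
  Matrix.of fun x y => if x = y then (if x 0 = true then adhUnit else 1) else 0

/-- The inverse phase gate `P_θ⁻¹ = diag(1, (3-4i)/5)`. [folklore] -/
def adhPhaseInvGate : Matrix (QReg 1) (QReg 1) ℂ :=
  Matrix.of fun x y => if x = y then (if x 0 = true then adhUnitInv else 1) else 0

/-- **The Adleman–DeMarrais–Huang gate set** `{R_θ, R_θ⁻¹, P_θ, P_θ⁻¹, CNOT}` (arities `1, 1, 1, 1, 2`):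
all entries lie in `{0, 1, 3/5, ±4/5, (3 ± 4i)/5}`, so their real and imaginary parts are
Adleman–DeMarrais–Huang amplitudes. [cite: AdlemanDeMarraisHuangSICOMP1997, §2 and Thm. 3.3(e)] -/
def adhGateSet : QGateSet where
  Op := ADHOp
  arity
    | .R => 1
    | .Rinv => 1
    | .P => 1
    | .Pinv => 1
    | .CNOT => 2
  mat
    | .R => adhRotGate
    | .Rinv => adhRotInvGate
    | .P => adhPhaseGate
    | .Pinv => adhPhaseInvGate
    | .CNOT => cnot

/-- The gate alphabet is finite. [folklore] -/
instance : Finite adhGateSet.Op := inferInstanceAs (Finite ADHOp)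

/-- The gate alphabet is encodable. [folklore] -/
instance instEncodableOpAdhGateSet : Encodable adhGateSet.Op := inferInstanceAs (Encodable ADHOp)

/-! ### Arithmetic of `(3 ± 4i)/5` -/

/-- `e^{iθ} = (3+4i)/5` for the ADH angle. [cite: AdlemanDeMarraisHuangSICOMP1997, Thm. 3.3(e)] -/
theorem exp_adhAngle_mul_I : cexp (adhAngle * I) = adhUnit := by
  rw [Complex.exp_mul_I, adhUnit]
  exact cos_adhAngle_add_sin_adhAngle_mul_I

/-- `(3-4i)/5` is the complex conjugate of `(3+4i)/5`. [folklore] -/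
theorem star_adhUnit : star adhUnit = adhUnitInv := by
  rw [adhUnit, adhUnitInv, Complex.star_def, map_div₀, map_add, map_mul, Complex.conj_I]
  simp only [map_ofNat]
  ring

/-- `(3+4i)/5 · (3-4i)/5 = 1`. [folklore] -/
theorem adhUnit_mul_adhUnitInv : adhUnit * adhUnitInv = 1 := by
  rw [adhUnit, adhUnitInv]
  have hI : I * I = -1 := Complex.I_mul_I
  field_simp
  linear_combination (-16 : ℂ) * hI

/-- `(3-4i)/5 · (3+4i)/5 = 1`. [folklore] -/
theorem adhUnitInv_mul_adhUnit : adhUnitInv * adhUnit = 1 := by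
  rw [mul_comm, adhUnit_mul_adhUnitInv]

/-- `‖(3+4i)/5‖ = 1`. [folklore] -/
theorem norm_adhUnit : ‖adhUnit‖ = 1 := by
  rw [← exp_adhAngle_mul_I]
  exact Complex.norm_exp_ofReal_mul_I adhAngle

/-- Real part `3/5`. [folklore] -/
theorem adhUnit_re : adhUnit.re = 3 / 5 := by
  norm_num [adhUnit]

/-- Imaginary part `4/5`. [folklore] -/
theorem adhUnit_im : adhUnit.im = 4 / 5 := by
  norm_num [adhUnit]

/-- Real part `3/5`. [folklore] -/
theorem adhUnitInv_re : adhUnitInv.re = 3 / 5 := by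
  norm_num [adhUnitInv]

/-- Imaginary part `-4/5`. [folklore] -/
theorem adhUnitInv_im : adhUnitInv.im = -(4 / 5) := by
  norm_num [adhUnitInv]

/-! ### The entries and their real and imaginary parts -/

/-- The finite set of entries of the ADH gates. [folklore] -/
def adhEntries : Set ℂ := {0, 1, 3 / 5, 4 / 5, -(4 / 5), adhUnit, adhUnitInv}

/-- Every entry of every ADH gate lies in `adhEntries`. [cite: AdlemanDeMarraisHuangSICOMP1997, §2] -/
theorem adhGateSet_mat_mem_adhEntries (g : adhGateSet.Op) (i j : QReg (adhGateSet.arity g)) :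
    adhGateSet.mat g i j ∈ adhEntries := by
  rcases g with _ | _ | _ | _ | _
  · change adhRotGate i j ∈ adhEntries
    rw [adhRotGate, Matrix.of_apply]
    split_ifs <;> simp [adhEntries]
  · change adhRotInvGate i j ∈ adhEntries
    rw [adhRotInvGate, Matrix.of_apply]
    split_ifs <;> simp [adhEntries]
  · change adhPhaseGate i j ∈ adhEntries
    rw [adhPhaseGate, Matrix.of_apply]
    split_ifs <;> simp [adhEntries]
  · change adhPhaseInvGate i j ∈ adhEntries
    rw [adhPhaseInvGate, Matrix.of_apply]
    split_ifs <;> simp [adhEntries]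
  · change cnot i j ∈ adhEntries
    rw [cnot, Matrix.of_apply]
    split_ifs <;> simp [adhEntries]

/-- Real parts of the entries are ADH amplitudes. [cite: AdlemanDeMarraisHuangSICOMP1997, Thm. 3.3(e)] -/
theorem re_mem_adhAmplitudes_of_mem_adhEntries {z : ℂ} (hz : z ∈ adhEntries) : ((z.re : ℝ) : ℂ) ∈ adhAmplitudes := by
  simp only [adhEntries, Set.mem_insert_iff, Set.mem_singleton_iff] at hz
  rcases hz with rfl | rfl | rfl | rfl | rfl | rfl | rfl
  · simp [adhAmplitudes]
  · simp [adhAmplitudes]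
  · rw [show ((3 : ℂ) / 5).re = 3 / 5 by norm_num]
    simp [adhAmplitudes]
  · rw [show ((4 : ℂ) / 5).re = 4 / 5 by norm_num]
    norm_num [adhAmplitudes]
  · rw [show (-((4 : ℂ) / 5)).re = -(4 / 5) by norm_num]
    norm_num [adhAmplitudes]
  · rw [adhUnit_re]
    simp [adhAmplitudes]
  · rw [adhUnitInv_re]
    simp [adhAmplitudes]

/-- Imaginary parts of the entries are ADH amplitudes. [cite: AdlemanDeMarraisHuangSICOMP1997, Thm. 3.3(e)] -/
theorem im_mem_adhAmplitudes_of_mem_adhEntries {z : ℂ} (hz : z ∈ adhEntries) : ((z.im : ℝ) : ℂ) ∈ adhAmplitudes := by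
  simp only [adhEntries, Set.mem_insert_iff, Set.mem_singleton_iff] at hz
  rcases hz with rfl | rfl | rfl | rfl | rfl | rfl | rfl
  · simp [adhAmplitudes]
  · simp [adhAmplitudes]
  · rw [show ((3 : ℂ) / 5).im = 0 by norm_num]
    simp [adhAmplitudes]
  · rw [show ((4 : ℂ) / 5).im = 0 by norm_num]
    simp [adhAmplitudes]
  · rw [show (-((4 : ℂ) / 5)).im = 0 by norm_num]
    simp [adhAmplitudes]
  · rw [adhUnit_im]
    norm_num [adhAmplitudes]
  · rw [adhUnitInv_im]
    norm_num [adhAmplitudes]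

/-- **Real parts of all gate entries are in `adhAmplitudes`** (what a realified executor with ADH
amplitudes uses). [cite: AdlemanDeMarraisHuangSICOMP1997, Thm. 3.3(e)] -/
theorem adhGateSet_re_mem_adhAmplitudes (g : adhGateSet.Op) (i j : QReg (adhGateSet.arity g)) :
    (((adhGateSet.mat g i j).re : ℝ) : ℂ) ∈ adhAmplitudes :=
  re_mem_adhAmplitudes_of_mem_adhEntries (adhGateSet_mat_mem_adhEntries g i j)

/-- **Imaginary parts of all gate entries are in `adhAmplitudes`.** [cite: AdlemanDeMarraisHuangSICOMP1997, Thm. 3.3(e)] -/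
theorem adhGateSet_im_mem_adhAmplitudes (g : adhGateSet.Op) (i j : QReg (adhGateSet.arity g)) :
    (((adhGateSet.mat g i j).im : ℝ) : ℂ) ∈ adhAmplitudes :=
  im_mem_adhAmplitudes_of_mem_adhEntries (adhGateSet_mat_mem_adhEntries g i j)

/-- **Polynomial-time computable entries** (they are Gaussian rationals; Bernstein–Vazirani's class `C̃`
is a subfield containing `i`). [cite: BernsteinVazirani1997, §6] -/
theorem adhGateSet_polyTime (g : adhGateSet.Op) (i j : QReg (adhGateSet.arity g)) :
    adhGateSet.mat g i j ∈ polyTimeComputableComplex := by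
  have hK : ∀ z ∈ adhEntries, z ∈ QTM.polyTimeComputableSubfield := by
    intro z hz
    have hI : I ∈ QTM.polyTimeComputableSubfield := (QTM.mem_polyTimeComputableSubfield _).2 isPolyTimeComputableComplex_I
    have h3 : (3 : ℂ) ∈ QTM.polyTimeComputableSubfield := by exact_mod_cast natCast_mem QTM.polyTimeComputableSubfield 3
    have h4 : (4 : ℂ) ∈ QTM.polyTimeComputableSubfield := by exact_mod_cast natCast_mem QTM.polyTimeComputableSubfield 4
    have h5 : (5 : ℂ) ∈ QTM.polyTimeComputableSubfield := by exact_mod_cast natCast_mem QTM.polyTimeComputableSubfield 5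
    simp only [adhEntries, Set.mem_insert_iff, Set.mem_singleton_iff] at hz
    rcases hz with rfl | rfl | rfl | rfl | rfl | rfl | rfl
    · exact QTM.polyTimeComputableSubfield.zero_mem
    · exact QTM.polyTimeComputableSubfield.one_mem
    · exact QTM.polyTimeComputableSubfield.div_mem h3 h5
    · exact QTM.polyTimeComputableSubfield.div_mem h4 h5
    · exact QTM.polyTimeComputableSubfield.neg_mem (QTM.polyTimeComputableSubfield.div_mem h4 h5)
    · exact QTM.polyTimeComputableSubfield.div_mem
        (QTM.polyTimeComputableSubfield.add_mem h3 (QTM.polyTimeComputableSubfield.mul_mem h4 hI)) h5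
    · exact QTM.polyTimeComputableSubfield.div_mem
        (QTM.polyTimeComputableSubfield.sub_mem h3 (QTM.polyTimeComputableSubfield.mul_mem h4 hI)) h5
  exact (QTM.mem_polyTimeComputableSubfield _).1 (hK _ (adhGateSet_mat_mem_adhEntries g i j))

/-! ### The one-qubit gates on `Fin 2`, unitarity, inverse-closedness -/

/-- `cos θ = 3/5` in `ℂ`. [cite: AdlemanDeMarraisHuangSICOMP1997, Thm. 3.3(e)] -/
theorem complex_cos_adhAngle : Complex.cos (adhAngle : ℂ) = 3 / 5 := by
  rw [← Complex.ofReal_cos, cos_adhAngle]; push_cast; ring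

/-- `sin θ = 4/5` in `ℂ`. [cite: AdlemanDeMarraisHuangSICOMP1997, Thm. 3.3(e)] -/
theorem complex_sin_adhAngle : Complex.sin (adhAngle : ℂ) = 4 / 5 := by
  rw [← Complex.ofReal_sin, sin_adhAngle]; push_cast; ring

/-- Reindexed along `qRegOneEquiv`, `R_θ` is the rotation matrix `rotMatrix θ`. [folklore] -/
theorem reindex_adhRotGate : Matrix.reindex qRegOneEquiv qRegOneEquiv adhRotGate = rotMatrix adhAngle := by
  ext i j
  fin_cases i <;> fin_cases j <;>
    simp [Matrix.reindex_apply, adhRotGate, rotMatrix, complex_cos_adhAngle, complex_sin_adhAngle]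

/-- Reindexed along `qRegOneEquiv`, `R_θ⁻¹` is `rotMatrix (-θ)`. [folklore] -/
theorem reindex_adhRotInvGate :
    Matrix.reindex qRegOneEquiv qRegOneEquiv adhRotInvGate = rotMatrix (-adhAngle) := by
  ext i j
  fin_cases i <;> fin_cases j <;>
    simp [Matrix.reindex_apply, adhRotInvGate, rotMatrix, complex_cos_adhAngle, complex_sin_adhAngle]

/-- Reindexed along `qRegOneEquiv`, `P_θ` is `diagMatrix 0 θ = diag(1, e^{iθ})`. [folklore] -/
theorem reindex_adhPhaseGate :
    Matrix.reindex qRegOneEquiv qRegOneEquiv adhPhaseGate = diagMatrix 0 adhAngle := by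
  ext i j
  fin_cases i <;> fin_cases j <;>
    simp [Matrix.reindex_apply, adhPhaseGate, diagMatrix, exp_adhAngle_mul_I]
  · exact fun h => absurd (congr_fun h 0) (by simp)
  · exact fun h => absurd (congr_fun h 0) (by simp)

/-- Reindexed along `qRegOneEquiv`, `P_θ⁻¹` is `diagMatrix 0 (-θ) = diag(1, e^{-iθ})`. [folklore] -/
theorem reindex_adhPhaseInvGate :
    Matrix.reindex qRegOneEquiv qRegOneEquiv adhPhaseInvGate = diagMatrix 0 (-adhAngle) := by
  have hexp : cexp (-((adhAngle : ℂ) * I)) = adhUnitInv := by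
    rw [← star_adhUnit, ← exp_adhAngle_mul_I, Complex.star_def, ← Complex.exp_conj]
    congr 1
    rw [map_mul, Complex.conj_ofReal, Complex.conj_I]
    ring
  ext i j
  fin_cases i <;> fin_cases j <;>
    simp [Matrix.reindex_apply, adhPhaseInvGate, diagMatrix, hexp]
  · exact fun h => absurd (congr_fun h 0) (by simp)
  · exact fun h => absurd (congr_fun h 0) (by simp)

/-- A matrix on `QReg 1` whose reindexing to `Fin 2` is unitary is unitary. [folklore] -/
theorem mem_unitaryGroup_of_reindex {A : Matrix (QReg 1) (QReg 1) ℂ}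
    (h : Matrix.reindex qRegOneEquiv qRegOneEquiv A ∈ Matrix.unitaryGroup (Fin 2) ℂ) : A ∈ Matrix.unitaryGroup (QReg 1) ℂ := by
  have h' := reindex_mem_unitaryGroup qRegOneEquiv.symm h
  simpa using h'

/-- `R_θ` is unitary. [folklore] -/
theorem adhRotGate_mem_unitaryGroup : adhRotGate ∈ Matrix.unitaryGroup (QReg 1) ℂ :=
  mem_unitaryGroup_of_reindex (by rw [reindex_adhRotGate]; exact rotMatrix_mem _)

/-- `R_θ⁻¹` is unitary. [folklore] -/
theorem adhRotInvGate_mem_unitaryGroup : adhRotInvGate ∈ Matrix.unitaryGroup (QReg 1) ℂ :=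
  mem_unitaryGroup_of_reindex (by rw [reindex_adhRotInvGate]; exact rotMatrix_mem _)

/-- `P_θ` is unitary. [folklore] -/
theorem adhPhaseGate_mem_unitaryGroup : adhPhaseGate ∈ Matrix.unitaryGroup (QReg 1) ℂ :=
  mem_unitaryGroup_of_reindex (by rw [reindex_adhPhaseGate]; exact diagMatrix_mem _ _)

/-- `P_θ⁻¹` is unitary. [folklore] -/
theorem adhPhaseInvGate_mem_unitaryGroup : adhPhaseInvGate ∈ Matrix.unitaryGroup (QReg 1) ℂ :=
  mem_unitaryGroup_of_reindex (by rw [reindex_adhPhaseInvGate]; exact diagMatrix_mem _ _)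

/-- **The ADH gate set is unitary.** [folklore] -/
theorem adhGateSet_isUnitary : adhGateSet.IsUnitary := by
  rintro (_ | _ | _ | _ | _)
  · exact adhRotGate_mem_unitaryGroup
  · exact adhRotInvGate_mem_unitaryGroup
  · exact adhPhaseGate_mem_unitaryGroup
  · exact adhPhaseInvGate_mem_unitaryGroup
  · exact cnot_mem_unitaryGroup_holds

/-- Matrices on `QReg 1` with equal reindexings are equal. [folklore] -/
theorem eq_of_reindex_eq {A B : Matrix (QReg 1) (QReg 1) ℂ}
    (h : Matrix.reindex qRegOneEquiv qRegOneEquiv A = Matrix.reindex qRegOneEquiv qRegOneEquiv B) : A = B :=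
  (Matrix.reindex qRegOneEquiv qRegOneEquiv).injective h

/-- `R_θ⁻¹ R_θ = 1`. [folklore] -/
theorem adhRotInvGate_mul_adhRotGate : adhRotInvGate * adhRotGate = 1 := by
  apply eq_of_reindex_eq
  rw [Matrix.reindex_apply, ← Matrix.submatrix_mul_equiv _ _ _ qRegOneEquiv.symm, ← Matrix.reindex_apply,
    ← Matrix.reindex_apply, reindex_adhRotInvGate, reindex_adhRotGate, ← rotMatrix_add, neg_add_cancel,
    rotMatrix_zero, Matrix.reindex_apply, Matrix.submatrix_one_equiv]

/-- `R_θ R_θ⁻¹ = 1`. [folklore] -/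
theorem adhRotGate_mul_adhRotInvGate : adhRotGate * adhRotInvGate = 1 := by
  apply eq_of_reindex_eq
  rw [Matrix.reindex_apply, ← Matrix.submatrix_mul_equiv _ _ _ qRegOneEquiv.symm, ← Matrix.reindex_apply,
    ← Matrix.reindex_apply, reindex_adhRotInvGate, reindex_adhRotGate, ← rotMatrix_add, add_neg_cancel,
    rotMatrix_zero, Matrix.reindex_apply, Matrix.submatrix_one_equiv]

/-- `P_θ⁻¹ P_θ = 1`. [folklore] -/
theorem adhPhaseInvGate_mul_adhPhaseGate : adhPhaseInvGate * adhPhaseGate = 1 := by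
  apply eq_of_reindex_eq
  rw [Matrix.reindex_apply, ← Matrix.submatrix_mul_equiv _ _ _ qRegOneEquiv.symm, ← Matrix.reindex_apply,
    ← Matrix.reindex_apply, reindex_adhPhaseInvGate, reindex_adhPhaseGate, ← diagMatrix_add, add_zero,
    neg_add_cancel, diagMatrix_zero, Matrix.reindex_apply, Matrix.submatrix_one_equiv]

/-- `P_θ P_θ⁻¹ = 1`. [folklore] -/
theorem adhPhaseGate_mul_adhPhaseInvGate : adhPhaseGate * adhPhaseInvGate = 1 := by
  apply eq_of_reindex_eq
  rw [Matrix.reindex_apply, ← Matrix.submatrix_mul_equiv _ _ _ qRegOneEquiv.symm, ← Matrix.reindex_apply,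
    ← Matrix.reindex_apply, reindex_adhPhaseInvGate, reindex_adhPhaseGate, ← diagMatrix_add, add_zero,
    add_neg_cancel, diagMatrix_zero, Matrix.reindex_apply, Matrix.submatrix_one_equiv]

/-- **The ADH gate set is inverse-closed**: `R_θ ↔ R_θ⁻¹`, `P_θ ↔ P_θ⁻¹`, `CNOT² = 1`. [folklore] -/
theorem adhGateSet_isInverseClosed : adhGateSet.IsInverseClosed := by
  intro n P hP
  obtain ⟨g, e, rfl⟩ := hP
  have one : ∀ (k : ℕ) (e : Fin k ↪ Fin n) (U V : Matrix (QReg k) (QReg k) ℂ),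
      placeGate e V ∈ placements adhGateSet n → V * U = 1 →
      ∃ l : List (Matrix (QReg n) (QReg n) ℂ), (∀ N ∈ l, N ∈ placements adhGateSet n) ∧
        l.prod * placeGate e U = 1 := by
    intro k e U V hV h
    refine ⟨[placeGate e V], ?_, ?_⟩
    · intro N hN
      rw [List.mem_singleton] at hN
      subst hN
      exact hV
    · rw [List.prod_singleton, ← placeGate_mul_holds, h, placeGate_one]
  rcases g with _ | _ | _ | _ | _
  · exact one _ e _ adhRotInvGate ⟨ADHOp.Rinv, e, rfl⟩ adhRotInvGate_mul_adhRotGate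
  · exact one _ e _ adhRotGate ⟨ADHOp.R, e, rfl⟩ adhRotGate_mul_adhRotInvGate
  · exact one _ e _ adhPhaseInvGate ⟨ADHOp.Pinv, e, rfl⟩ adhPhaseInvGate_mul_adhPhaseGate
  · exact one _ e _ adhPhaseGate ⟨ADHOp.P, e, rfl⟩ adhPhaseGate_mul_adhPhaseInvGate
  · exact one _ e _ cnot ⟨ADHOp.CNOT, e, rfl⟩ cnot_mul_self

/-! ### `⟨R_θ, P_θ, phases⟩` is dense in `U(2)` -/

/-- The generators on `Fin 2`: `R_θ = rotMatrix θ`, `P_θ = diagMatrix 0 θ` and the global phases. [folklore] -/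
def adhPhaseGen : Set (Matrix.unitaryGroup (Fin 2) ℂ) :=
  {U | (U : Matrix (Fin 2) (Fin 2) ℂ) ∈ ({rotMatrix adhAngle, diagMatrix 0 adhAngle} : Set (Matrix (Fin 2) (Fin 2) ℂ)) ∨
    ∃ c : ℂ, (U : Matrix (Fin 2) (Fin 2) ℂ) = c • (1 : Matrix (Fin 2) (Fin 2) ℂ)}

/-- **Main theorem (matrix form on `Fin 2`).** The closure `K` of the subgroup of `U(2)` generated by
`R_θ`, `P_θ` and the phases is all of `U(2)`: `diag(e^{iθ}, 1) = e^{iθ} · P_θ⁻¹ ∈ K`, `θ/2π ∉ ℚ`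
(`irrational_adhAngle_div_two_pi`), so the closed subgroup `{t | diag(e^{it}, 1) ∈ K}` of `ℝ` is dense
(Kronecker, `dense_addSubgroupClosure_pair_iff`), hence everything, and with the phases `K` contains the
diagonal torus; `R_θ ∈ K` has `(R_θ)₀₀ = 3/5 ≠ 0` and `(R_θ)₁₀ = 4/5 ≠ 0`, so two tori generate
(`unitaryGroup_fin_two_eq_top_of_diagU_mem`). This replaces the Diophantine input of
Adleman–DeMarrais–Huang's Thm. 3.3 (non-Liouville `θ/2π`, Lemma 3.6) by plain irrationality, at the
price of the second, non-commuting generator `P_θ`. [cite: AdlemanDeMarraisHuangSICOMP1997, Thm. 3.3 (d)–(e), p. 1530] -/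
theorem topologicalClosure_closure_adhPhaseGen :
    (Subgroup.closure adhPhaseGen).topologicalClosure = ⊤ := by
  set Γ : Subgroup (Matrix.unitaryGroup (Fin 2) ℂ) := Subgroup.closure adhPhaseGen with hΓ
  set K : Subgroup (Matrix.unitaryGroup (Fin 2) ℂ) := Γ.topologicalClosure with hK
  have hKc : IsClosed (K : Set (Matrix.unitaryGroup (Fin 2) ℂ)) := Subgroup.isClosed_topologicalClosure Γ
  have hΓK : Γ ≤ K := Subgroup.le_topologicalClosure Γ
  have hRΓ : rotU adhAngle ∈ Γ := Subgroup.subset_closure (Or.inl (Or.inl rfl))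
  have hPΓ : diagU 0 adhAngle ∈ Γ := Subgroup.subset_closure (Or.inl (Or.inr rfl))
  have hcΓ : ∀ (c : ℂ) (hc : ‖c‖ = 1), (⟨c • 1, phase_mem_unitaryGroup hc⟩ : Matrix.unitaryGroup (Fin 2) ℂ) ∈ Γ := fun c hc =>
    Subgroup.subset_closure (Or.inr ⟨c, rfl⟩)
  -- `diag(e^{iθ}, 1) = (e^{iθ} • 1) · P_θ⁻¹ ∈ Γ`
  have hθn : ‖cexp (adhAngle * I)‖ = 1 := Complex.norm_exp_ofReal_mul_I adhAngle
  have hmul : diagU adhAngle 0 * diagU 0 adhAngle = ⟨cexp (adhAngle * I) • 1, phase_mem_unitaryGroup hθn⟩ := by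
    rw [← diagU_add, add_zero, zero_add]
    exact Subtype.ext (by rw [coe_diagU]; exact diagMatrix_self adhAngle)
  have hθΓ : diagU adhAngle 0 ∈ Γ := by
    rw [eq_mul_inv_of_mul_eq hmul]
    exact Γ.mul_mem (hcΓ _ hθn) (Γ.inv_mem hPΓ)
  -- the closed subgroup `Θ = {t | diag(e^{it}, 1) ∈ K}` of `ℝ`
  let Θ : AddSubgroup ℝ :=
    { carrier := {t | diagU t 0 ∈ K}
      zero_mem' := by
        change diagU 0 0 ∈ K
        rw [diagU_zero]
        exact K.one_mem
      add_mem' := fun {a b} ha hb => by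
        change diagU (a + b) 0 ∈ K
        have h : diagU (a + b) 0 = diagU a 0 * diagU b 0 := by simpa using diagU_add a 0 b 0
        rw [h]
        exact K.mul_mem ha hb
      neg_mem' := fun {a} ha => by
        change diagU (-a) 0 ∈ K
        have h : diagU (-a) 0 = (diagU a 0)⁻¹ := by simpa using diagU_neg a 0
        rw [h]
        exact K.inv_mem ha }
  have hΘc : IsClosed (Θ : Set ℝ) := hKc.preimage (continuous_diagU 0)
  have h2π : (2 * Real.pi) ∈ Θ := by
    change diagU (2 * Real.pi) 0 ∈ K
    have h : diagU (2 * Real.pi) 0 = 1 := Subtype.ext (by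
      rw [coe_diagU]
      change diagMatrix (2 * Real.pi) 0 = 1
      unfold diagMatrix
      push_cast
      rw [Complex.exp_two_pi_mul_I, zero_mul, Complex.exp_zero, Matrix.one_fin_two])
    rw [h]
    exact K.one_mem
  have hθΘ : adhAngle ∈ Θ := hΓK hθΓ
  have hΘd : Dense (Θ : Set ℝ) := by
    have hle : AddSubgroup.closure {adhAngle, 2 * Real.pi} ≤ Θ := by
      rw [AddSubgroup.closure_le]
      intro x hx
      rcases hx with rfl | rfl
      · exact hθΘ
      · exact h2π
    exact (dense_addSubgroupClosure_pair_iff.2 irrational_adhAngle_div_two_pi).mono hle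
  have hΘuniv : (Θ : Set ℝ) = Set.univ := by
    rw [← hΘc.closure_eq]
    exact hΘd.closure_eq
  have hdiag0 : ∀ t : ℝ, diagU t 0 ∈ K := fun t => by
    have h : t ∈ (Θ : Set ℝ) := hΘuniv ▸ Set.mem_univ t
    exact h
  have hdiagK : ∀ a b : ℝ, diagU a b ∈ K := by
    intro a b
    have hcb : ‖cexp (b * I)‖ = 1 := Complex.norm_exp_ofReal_mul_I b
    have heq : diagU a b = ⟨cexp (b * I) • 1, phase_mem_unitaryGroup hcb⟩ * diagU (a - b) 0 := Subtype.ext (by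
      rw [Submonoid.coe_mul, coe_diagU, coe_diagU]
      change diagMatrix a b = cexp (b * I) • (1 : Matrix (Fin 2) (Fin 2) ℂ) * diagMatrix (a - b) 0
      rw [← diagMatrix_self, ← diagMatrix_add]
      congr 1 <;> ring)
    rw [heq]
    exact K.mul_mem (hΓK (hcΓ _ hcb)) (hdiag0 _)
  -- `R_θ ∈ K` does not normalise the torus
  have hRK : rotU adhAngle ∈ K := hΓK hRΓ
  have h00 : ((rotU adhAngle : Matrix.unitaryGroup (Fin 2) ℂ) : Matrix (Fin 2) (Fin 2) ℂ) 0 0 ≠ 0 := by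
    rw [coe_rotU]
    simp [rotMatrix, complex_cos_adhAngle]
  have h10 : ((rotU adhAngle : Matrix.unitaryGroup (Fin 2) ℂ) : Matrix (Fin 2) (Fin 2) ℂ) 1 0 ≠ 0 := by
    rw [coe_rotU]
    simp [rotMatrix, complex_sin_adhAngle]
  exact unitaryGroup_fin_two_eq_top_of_diagU_mem K hdiagK hRK h00 h10

/-- **`R_θ` and `P_θ` generate `U(QReg 1)` densely modulo phase** (transport of
`topologicalClosure_closure_adhPhaseGen` along the reindexing `QReg 1 ≃ Fin 2`). [cite: AdlemanDeMarraisHuangSICOMP1997, Thm. 3.3(e)] -/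
theorem adhRotPhase_generatesDenselyModPhase :
    GeneratesDenselyModPhase 1 ({adhRotGate, adhPhaseGate} : Set (Matrix (QReg 1) (QReg 1) ℂ)) := by
  unfold GeneratesDenselyModPhase
  set S1 : Set (Matrix.unitaryGroup (QReg 1) ℂ) :=
    {U | U.1 ∈ ({adhRotGate, adhPhaseGate} : Set (Matrix (QReg 1) (QReg 1) ℂ)) ∨
      ∃ c : ℂ, U.1 = c • (1 : Matrix (QReg 1) (QReg 1) ℂ)} with hS1
  set ψ := unitaryReindex (m := QReg 1) (n := Fin 2) qRegOneEquiv with hψ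
  set ψ' := unitaryReindex (m := Fin 2) (n := QReg 1) qRegOneEquiv.symm with hψ'
  have hgen : adhPhaseGen ⊆ ψ '' S1 := by
    rintro U (hU | ⟨c, hc⟩)
    · rcases hU with hR | hP
      · refine ⟨⟨adhRotGate, adhRotGate_mem_unitaryGroup⟩, Or.inl (Or.inl rfl), Subtype.ext ?_⟩
        rw [hψ, coe_unitaryReindex, hR]
        exact reindex_adhRotGate
      · rw [Set.mem_singleton_iff] at hP
        refine ⟨⟨adhPhaseGate, adhPhaseGate_mem_unitaryGroup⟩, Or.inl (Or.inr rfl), Subtype.ext ?_⟩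
        rw [hψ, coe_unitaryReindex, hP]
        exact reindex_adhPhaseGate
    · have hmem : c • (1 : Matrix (QReg 1) (QReg 1) ℂ) ∈ Matrix.unitaryGroup (QReg 1) ℂ := by
        have h := reindex_mem_unitaryGroup qRegOneEquiv.symm U.2
        rwa [hc, reindex_smul_one] at h
      refine ⟨⟨c • 1, hmem⟩, Or.inr ⟨c, rfl⟩, Subtype.ext ?_⟩
      rw [hψ, coe_unitaryReindex, hc]
      exact reindex_smul_one qRegOneEquiv c
  have hle : Subgroup.closure adhPhaseGen ≤ (Subgroup.closure S1).map ψ := by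
    rw [MonoidHom.map_closure]
    exact Subgroup.closure_mono hgen
  have hdense : Dense ((Subgroup.closure adhPhaseGen : Subgroup (Matrix.unitaryGroup (Fin 2) ℂ)) :
      Set (Matrix.unitaryGroup (Fin 2) ℂ)) := by
    rw [dense_iff_closure_eq, ← Subgroup.topologicalClosure_coe, topologicalClosure_closure_adhPhaseGen,
      Subgroup.coe_top]
  have hd2 : Dense (((Subgroup.closure S1).map ψ : Subgroup (Matrix.unitaryGroup (Fin 2) ℂ)) :
      Set (Matrix.unitaryGroup (Fin 2) ℂ)) :=
    hdense.mono hle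
  have hsurj : Function.Surjective ψ' := fun A => ⟨ψ A, unitaryReindex_symm_apply _ A⟩
  have himage : ψ' '' (((Subgroup.closure S1).map ψ : Subgroup (Matrix.unitaryGroup (Fin 2) ℂ)) :
      Set (Matrix.unitaryGroup (Fin 2) ℂ)) = (Subgroup.closure S1 : Set (Matrix.unitaryGroup (QReg 1) ℂ)) := by
    ext A
    simp only [Subgroup.coe_map, Set.mem_image, SetLike.mem_coe]
    constructor
    · rintro ⟨B, ⟨A', hA', rfl⟩, rfl⟩
      rw [hψ, hψ', unitaryReindex_symm_apply]
      exact hA'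
    · intro hA
      exact ⟨ψ A, ⟨A, hA, rfl⟩, unitaryReindex_symm_apply _ A⟩
  rw [← himage]
  exact hsurj.denseRange.dense_image (continuous_unitaryReindex _) hd2

/-! ### Universality on `n` wires and `BQPOver adhGateSet = BQP` -/

/-- Placements of ADH gates, by symbol. [folklore] -/
theorem placeGate_mem_placements_adhGateSet {n : ℕ} (g : ADHOp) (e : Fin (adhGateSet.arity g) ↪ Fin n) :
    placeGate e (adhGateSet.mat g) ∈ placements adhGateSet n :=
  ⟨g, e, rfl⟩

/-- **The ADH placements generate `U(2^n)` densely modulo phase, `n ≥ 1`** (assembly as in Boykin et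
al. 1999, §3 / `hTCnot_generatesDenselyModPhase_of`: the closure of the generated group pulls back along
each one-wire placement homomorphism to a closed subgroup of `U(2)` containing `R_θ`, `P_θ` and the
phases, hence all one-qubit placements lie in it; so do the `CNOT` placements; Barenco et al. 1995
finish). [cite: BarencoEtAl1995, abstract and §8] -/
theorem adhGateSet_generatesDenselyModPhase (n : ℕ) (hn : 1 ≤ n) :
    GeneratesDenselyModPhase n (placements adhGateSet n) := by
  set Sn : Set (Matrix.unitaryGroup (QReg n) ℂ) :=
    {U | U.1 ∈ placements adhGateSet n ∨ ∃ c : ℂ, U.1 = c • (1 : Matrix (QReg n) (QReg n) ℂ)} with hSn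
  set Γ : Subgroup (Matrix.unitaryGroup (QReg n) ℂ) := Subgroup.closure Sn with hΓ
  set K : Subgroup (Matrix.unitaryGroup (QReg n) ℂ) := Γ.topologicalClosure with hK
  have hKcoe : (K : Set (Matrix.unitaryGroup (QReg n) ℂ)) = closure (Γ : Set _) :=
    Subgroup.topologicalClosure_coe
  suffices hTop : K = ⊤ by
    change Dense (Γ : Set (Matrix.unitaryGroup (QReg n) ℂ))
    rw [dense_iff_closure_eq, ← hKcoe, hTop, Subgroup.coe_top]
  have hΓK : Γ ≤ K := Subgroup.le_topologicalClosure Γ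
  -- (1) every one-qubit placement lies in `K`
  have h1 : ∀ (e : Fin 1 ↪ Fin n) (V : Matrix.unitaryGroup (QReg 1) ℂ), placeGateHom e V ∈ K := by
    intro e V
    set S1 : Set (Matrix.unitaryGroup (QReg 1) ℂ) :=
      {U | U.1 ∈ ({adhRotGate, adhPhaseGate} : Set (Matrix (QReg 1) (QReg 1) ℂ)) ∨
        ∃ c : ℂ, U.1 = c • (1 : Matrix (QReg 1) (QReg 1) ℂ)} with hS1
    have hV : V ∈ closure ((Subgroup.closure S1 : Subgroup (Matrix.unitaryGroup (QReg 1) ℂ)) :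
        Set (Matrix.unitaryGroup (QReg 1) ℂ)) := by
      have hdense : Dense ((Subgroup.closure S1 : Subgroup (Matrix.unitaryGroup (QReg 1) ℂ)) :
          Set (Matrix.unitaryGroup (QReg 1) ℂ)) := adhRotPhase_generatesDenselyModPhase
      rw [hdense.closure_eq]
      exact Set.mem_univ V
    have hsub : (placeGateHom e) '' ((Subgroup.closure S1 : Subgroup (Matrix.unitaryGroup (QReg 1) ℂ)) :
        Set (Matrix.unitaryGroup (QReg 1) ℂ)) ⊆ (Γ : Set (Matrix.unitaryGroup (QReg n) ℂ)) := by
      have hle : Subgroup.map (placeGateHom e) (Subgroup.closure S1) ≤ Γ := by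
        rw [MonoidHom.map_closure, hΓ]
        refine (Subgroup.closure_le _).mpr ?_
        rintro _ ⟨W, hW, rfl⟩
        apply Subgroup.subset_closure
        rcases hW with hW | ⟨c, hc⟩
        · left
          rcases hW with hWR | hWP
          · rw [coe_placeGateHom, hWR]
            exact placeGate_mem_placements_adhGateSet ADHOp.R e
          · rw [Set.mem_singleton_iff] at hWP
            rw [coe_placeGateHom, hWP]
            exact placeGate_mem_placements_adhGateSet ADHOp.P e
        · right
          exact ⟨c, by rw [coe_placeGateHom, hc, placeGate_smul_one]⟩
      rintro _ ⟨W, hW, rfl⟩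
      exact hle ⟨W, hW, rfl⟩
    have hmem : placeGateHom e V ∈ closure ((placeGateHom e) ''
        ((Subgroup.closure S1 : Subgroup (Matrix.unitaryGroup (QReg 1) ℂ)) :
          Set (Matrix.unitaryGroup (QReg 1) ℂ))) :=
      image_closure_subset_closure_image (continuous_placeGateHom e) ⟨V, hV, rfl⟩
    have hmem' : placeGateHom e V ∈ (K : Set (Matrix.unitaryGroup (QReg n) ℂ)) := by
      rw [hKcoe]
      exact closure_mono hsub hmem
    exact hmem'
  -- (2) every `CNOT` placement lies in `Γ ≤ K`
  have h2 : ∀ e : Fin 2 ↪ Fin n,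
      (⟨placeGate e cnot, placeGate_mem_unitaryGroup_holds e cnot_mem_unitaryGroup_holds⟩ :
        Matrix.unitaryGroup (QReg n) ℂ) ∈ K := by
    intro e
    apply hΓK
    apply Subgroup.subset_closure
    left
    exact placeGate_mem_placements_adhGateSet ADHOp.CNOT e
  -- (3) Barenco et al.: one-qubit placements and `CNOT`s generate everything
  rw [eq_top_iff, ← barenco1995_exactUniversality_holds n hn]
  refine (Subgroup.closure_le _).mpr ?_
  rintro U (⟨e, V, hU⟩ | ⟨e, hU⟩)
  · have hUeq : U = placeGateHom e V := Subtype.ext (by rw [coe_placeGateHom]; exact hU)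
    rw [hUeq]
    exact h1 e V
  · have hUeq : U = ⟨placeGate e cnot,
        placeGate_mem_unitaryGroup_holds e cnot_mem_unitaryGroup_holds⟩ := Subtype.ext hU
    rw [hUeq]
    exact h2 e

/-- **The ADH gate set is universal** at the placement level (threshold `n₀ = 1`). [cite: AdlemanDeMarraisHuangSICOMP1997, Thm. 3.3(e)] -/
theorem adhGateSet_isUniversal : adhGateSet.IsUniversal :=
  ⟨1, adhGateSet_generatesDenselyModPhase⟩

/-- **`BQPOver adhGateSet = BQP`**: polynomial-time uniform circuit families over
`{R_θ, R_θ⁻¹, P_θ, P_θ⁻¹, CNOT}` decide exactly `BQP` — gate-set independence of `BQP`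
(`BQPOver_eq_BQP_holds`, the effective Solovay–Kitaev theorem of the tree) applied to the finite,
unitary, universal, inverse-closed gate set `adhGateSet` with rational complex entries. This is the
circuit-model form of Adleman–DeMarrais–Huang's Cor. 3.2 (`BQP_θ = BQP` for `cos θ = 3/5`).
[cite: AdlemanDeMarraisHuangSICOMP1997, Cor. 3.2 with Thm. 3.3(e)] -/
theorem BQPOver_adhGateSet_eq_BQP : BQPOver adhGateSet = BQP :=
  BQPOver_eq_BQP_holds adhGateSet adhGateSet_isUnitary adhGateSet_isUniversal adhGateSet_isInverseClosed
    adhGateSet_polyTime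

/-! ### S05 reduced to a circuit executor -/

/-- **`BQPQTM ⊆ BQP`, unconditionally** (the tree's head-centred simulation in the quotient semantics,
`BQPQTM_subset_BQP_of_gateSetIndependence`, fed with gate-set independence `BQPOver_eq_BQP_holds`):
Nishimura–Ozawa 2002, Thm. 4.3 / Thm. 5.2, one direction, for the tree's `BQPQTM`. [cite: NishimuraOzawa2002, Thm. 4.3 and Thm. 5.2] -/
theorem BQPQTM_subset_BQP : BQPQTM ⊆ BQP :=
  BQPQTM_subset_BQP_of_gateSetIndependence BQPOver_eq_BQP_holds

/-- Every `BQPQTM` language is decided by a uniform family of ADH circuits. [cite: AdlemanDeMarraisHuangSICOMP1997, Cor. 3.2] -/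
theorem BQPQTM_subset_BQPOver_adhGateSet : BQPQTM ⊆ BQPOver adhGateSet := by
  rw [BQPOver_adhGateSet_eq_BQP]
  exact BQPQTM_subset_BQP

/-- **The missing inclusion of S05 from a circuit executor with ADH amplitudes.** If every language
decided by a polynomial-time uniform family of circuits over `{R_θ, R_θ⁻¹, P_θ, P_θ⁻¹, CNOT}` is decided,
in the sense of `BQPQTMWith`, by a well-formed quantum Turing machine with amplitudes in
`{0, ±3/5, ±4/5, ±1}` (the realified circuit executor: Nishimura–Ozawa 2002, Lemma 4.4;
Bernstein–Vazirani 1997, §8; one extra tape bit carries real/imaginary parts, so the complex entries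
`(3 ± 4i)/5` cost only the amplitudes `3/5, ±4/5`), then `BQPQTM ⊆ BQPQTMWith adhAmplitudes`
(`BQPQTM ⊆ BQP = BQPOver adhGateSet ⊆ BQPQTMWith adhAmplitudes`). Together with the proved inclusion
`BQPQTMWith_adhAmplitudes_subset_BQPQTM` this is exactly the named fact
`BQPQTMWith_adhAmplitudes : BQPQTMWith adhAmplitudes = BQPQTM` (by `Set.Subset.antisymm`); it is stated
as the missing inclusion, a conditional reduction, so that no theorem of this file carries the type of
the open fact (D-0026 (ii)). [cite: AdlemanDeMarraisHuangSICOMP1997, Thm. 3.1 and Cor. 3.2 with Thm. 3.3(e)] -/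
theorem BQPQTM_subset_BQPQTMWith_adhAmplitudes_of_exec (hExec : BQPOver adhGateSet ⊆ BQPQTMWith adhAmplitudes) :
    BQPQTM ⊆ BQPQTMWith adhAmplitudes :=
  BQPQTM_subset_BQPOver_adhGateSet.trans hExec

/-- **Conversely**, given the Clifford+`T` executor `BQP ⊆ BQPQTM` (the remaining half of S04), S05 implies
the ADH executor statement; so modulo S04 the named fact `BQPQTMWith_adhAmplitudes` is EQUIVALENT to
`BQPOver adhGateSet ⊆ BQPQTMWith adhAmplitudes`. [cite: AdlemanDeMarraisHuangSICOMP1997, Cor. 3.2] -/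
theorem exec_of_BQPQTMWith_adhAmplitudes (h05 : BQPQTMWith_adhAmplitudes) (hNO : BQP ⊆ BQPQTM) :
    BQPOver adhGateSet ⊆ BQPQTMWith adhAmplitudes := by
  rw [BQPOver_adhGateSet_eq_BQP]
  unfold BQPQTMWith_adhAmplitudes at h05
  rw [h05]
  exact hNO

end Literature.Computability.QuantumComplexity

end
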